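import Literature.AnabelianGeometry.SemiGraphs.TemperedReconstructionR3cProofsAt
import Literature.AnabelianGeometry.SemiGraphs.TemperedReconstructionEdgeVertexProofs
import HarnessLib

/-!
# [SemiAnbd] Cor 3.9 step (R3c) `EdgeLikeCentralizerAt` WITHOUT Thm 3.7 (iii), first sentence —
# the residual of FACT-LIST row F-2773 sharpened (proof-only)

Mochizuki, *Semi-graphs of anabelioids*, Publ. RIMS **42** (2006), §3, Corollary 3.9, proof p. 43 l. 13
"[again by Theorem 3.7, (iii), (iv)]" [cite: MochizukiSemiAnbd2006, Cor 3.9 p.43]; Theorem 3.7 (ii) p. 40,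
(iii) pp. 40–41.

PROOF-ONLY companion of `TemperedReconstructionR3Sub.lean` (abc-iut cell, block F fact-proving wave, seat
abc-iut-f-176 gen 2; FACT-LIST rows F-2772 `EdgeLikeCentralizerAt` / F-2773 `EdgeLikeCentralizer`).  No
definition, no new named fact; nothing of the custody files is altered.

WHAT IS SHARPENED.  The tree proves (R3c) AT `ℋ` from Theorem 3.7 (iii) AT `ℋ`
(`edgeLikeCentralizerAt_of_compactInVerticialAt`, abc-iut-w4-d064 / abc-iut-w4-d080), i.e. from BOTH printed
sentences of (iii): conj 1 «every compact subgroup lies in a verticial subgroup» and conj 2 «a nontrivial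
compact subgroup lies in at most two».  Conj 1 holds at every FINITE graph (`compactInVerticialAt_of_finiteGraph`,
print p. 41 "since the semi-graphs `𝔾_j` are all finite") but is, on the cell's desk analysis, FALSE at some
countably infinite graphs of anabelioids satisfying the hypotheses of Thm. 3.7 (programme REFUTE-F1732: the ray
`𝒢_θ`), so that beyond finite graphs the only residual producer of F-2773 in the tree
(`edgeLikeCentralizer_of_compactInVerticialAt_cor39`) binds a hypothesis believed false.  Reading the proof of
`centralizer_map_le_of_mem_verticialSubgroupsAt` shows that conj 1 is used at ONE place only: to exclude that a
`ψ(U)`-centralising element SWAPS the two verticial hosts of `ψ(U)` — and such a swap forces the two hosts to sit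
at the SAME vertex (Thm. 3.7 (ii): a verticial subgroup determines its vertex), i.e. the edge to be a loop.
Hence, for `ℋ` as in Cor. 3.9, a chart `c`, an edge homomorphism `ψ` at `e`, an open `U ⊆ Π_e`, `C := ψ(U)`:

* `centralizer_map_le_of_twoHostsAt_of_noSwapAt` — (R3c) at `(e, ψ, U)` from (a) conj 2 of Thm. 3.7 (iii) AT THE
  ONE compact subgroup `C` and (b) «no `C`-centralising element conjugates one verticial host of `C` onto a
  different host of `C` at the same vertex»; conj 1 is not used;
* `centralizer_map_le_of_twoHostsAt` — if `e` joins two DISTINCT vertices, (a) alone suffices;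
* `centralizer_le_of_uniqueHostAt` — for ANY subgroup `C`: if `C` has at most one verticial host per vertex,
  its centraliser lies in every verticial host (two lines from Thm. 3.7 (ii); no (iii) at all);
* `edgeLikeCentralizerAt_of_twoHostsAt_of_isUntangled` — at an UNTANGLED `ℋ` (no loops; e.g. every
  tree-shaped `𝔾`, in particular the rays `𝒢_θ`), `EdgeLikeCentralizerAt ℋ c` follows from conj 2 at the open
  pieces of the edge-like subgroups alone; `edgeLikeCentralizer_of_twoHostsAt_of_noSwapAt` — the frozen fact
  F-2773 from the two sharpened hypotheses at the Cor-3.9 graphs;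
* comparison (`twoHostsAt_of_compactInVerticialAt`, `noSwapAt_of_compactInVerticialAt`, with
  `isCompact_map_and_ne_bot_of_isEdgeHom`): Theorem 3.7 (iii) AT `ℋ` implies both new hypotheses at `ψ(U)`,
  so the tree's closer `edgeLikeCentralizerAt_of_compactInVerticialAt` factors through
  `centralizer_map_le_of_twoHostsAt_of_noSwapAt` (not re-declared: same statement) — the sharpening is a
  genuine weakening of the residual, and the `K = ⟨H₁ ⊓ H₂, c₀⟩‾`-compactness step is isolated as the only
  consumer of conj 1.

Honest framing: OUR decomposition of one proof step; cone-irrelevant beyond finite graphs (every print consumer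
of Cor. 3.9 has a finite dual graph, where (R3c) is PROVED: `edgeLikeCentralizerAt_of_finiteGraph`); the truth of
conj 2 at open edge pieces for infinite `𝔾` is NOT claimed.  No side taken on [IUTchIII] Cor. 3.12; typed ≠ proved.
-/

open CategoryTheory Topology
open scoped Pointwise

namespace Literature.AnabelianGeometry.SemiGraphs

namespace ProfiniteSemiGraph

universe u

variable {ℋ : ProfiniteSemiGraph.{u}}

/-! ### Conjugation bookkeeping -/

/-- Conjugating a subgroup by one of its own elements does nothing. [cite: MochizukiSemiAnbd2006, Thm 3.7(ii) p.40] -/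
private theorem map_conj_eq_self_of_mem {Γ : Type u} [Group Γ] {K : Subgroup Γ} {g : Γ} (hg : g ∈ K) :
    K.map (MulAut.conj g).toMonoidHom = K := by
  ext x
  simp only [Subgroup.mem_map, MulEquiv.coe_toMonoidHom, MulAut.conj_apply]
  constructor
  · rintro ⟨y, hy, rfl⟩
    exact K.mul_mem (K.mul_mem hg hy) (K.inv_mem hg)
  · intro hx
    exact ⟨g⁻¹ * x * g, K.mul_mem (K.mul_mem (K.inv_mem hg) hx) hg, by group⟩

/-- Iterated conjugation. [cite: MochizukiSemiAnbd2006, Thm 3.7(ii) p.40] -/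
private theorem map_conj_map_conj {Γ : Type u} [Group Γ] (K : Subgroup Γ) (a b : Γ) :
    (K.map (MulAut.conj a).toMonoidHom).map (MulAut.conj b).toMonoidHom =
      K.map (MulAut.conj (b * a)).toMonoidHom := by
  rw [Subgroup.map_map]
  congr 1
  ext x
  simp [MulAut.conj_apply, mul_assoc]

/-- A centralising element conjugates every over-group of `C` to an over-group of `C`.
[cite: MochizukiSemiAnbd2006, Thm 3.7(iii) p.41] -/
private theorem le_map_conj_of_mem_centralizer {Γ : Type u} [Group Γ] {C K : Subgroup Γ} {g : Γ}
    (hg : g ∈ Subgroup.centralizer (C : Set Γ)) (hCK : C ≤ K) : C ≤ K.map (MulAut.conj g).toMonoidHom := by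
  intro x hx
  refine ⟨x, hCK hx, ?_⟩
  have h := Subgroup.mem_centralizer_iff.mp hg x hx
  simp only [MulEquiv.coe_toMonoidHom, MulAut.conj_apply]
  rw [← h, mul_inv_cancel_right]

/-! ### (R3c) from «at most one host per vertex» — Theorem 3.7 (ii) only -/

/-- **Centralisers lie in the hosts when hosts are unique per vertex** ([SemiAnbd] Thm. 3.7 (ii) p. 40,
commensurable terminality): for ANY subgroup `C` of `π₁^temp(H)` having at most one verticial host at each
vertex, the centraliser of `C` lies in every verticial subgroup `H ⊇ C` — for `g` centralising `C`,
`g H g⁻¹` is verticial at the same vertex and contains `C`, hence equals `H`, hence `g ∈ H`.  (For an open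
piece of the edge-like subgroup of a NON-loop edge this hypothesis follows from conj 2 of Thm. 3.7 (iii);
for a loop it fails — the two hosts sit at one vertex.) [cite: MochizukiSemiAnbd2006, Thm 3.7(ii) p.40] -/
theorem centralizer_le_of_uniqueHostAt (h37 : ℋ.Thm37Hypotheses) (c : TemperedPiChart ℋ)
    (C : Subgroup c.G)
    (h1 : ∀ (w : ℋ.graph.Vertex) (H₁ H₂ : Subgroup c.G), H₁ ∈ verticialSubgroups c w →
      H₂ ∈ verticialSubgroups c w → C ≤ H₁ → C ≤ H₂ → H₁ = H₂)
    (v : ℋ.graph.Vertex) (H : Subgroup c.G) (hH : H ∈ verticialSubgroups c v) (hCH : C ≤ H) :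
    Subgroup.centralizer (C : Set c.G) ≤ H := by
  intro g hg
  have hgH : H.map (MulAut.conj g).toMonoidHom = H :=
    h1 v _ _ (conj_mem_verticialSubgroups c hH g) hH (le_map_conj_of_mem_centralizer hg hCH) hCH
  exact mem_of_map_conj_eq_of_mem_verticialSubgroups verticialDistinct_holds h37 c hH hgH

/-! ### (R3c) from conj 2 of Thm 3.7 (iii) at `C` and «no swap at a vertex» -/

/-- **(R3c) at one edge homomorphism, WITHOUT Thm. 3.7 (iii) first sentence** ([SemiAnbd] Cor. 3.9
p. 43 l. 13): for `ℋ` as in Cor. 3.9, a chart `c`, an edge homomorphism `ψ` at `e`, an open `U ⊆ Π_e` and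
`C := ψ(U)`, assume (a) «`C` lies in at most the two verticial subgroups `H₁ ≠ H₂`» for every pair of distinct
hosts of `C` (conj 2 of Thm. 3.7 (iii) AT `C`) and (b) «no `C`-centralising `g` conjugates a host of `C` onto
a DIFFERENT host of `C` at the SAME vertex».  Then the centraliser of `C` lies in every verticial `H ⊇ C`.
Proof: the edge-like `L = ψ(Π_e) ⊇ C` has hosts `H₁ ≠ H₂` at the two end-vertices `w₁`, `w₂` of `e`
(`exists_verticial_pair_of_mem_edgeLikeSubgroups`); by (a) they are all the hosts of `C`, so conjugation by
a centralising `c₀` permutes `{H₁, H₂}`; a fixed point gives `c₀ ∈ H₁ ∩ H₂` by commensurable terminality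
(Thm. 3.7 (ii)); a swap puts `H₂ = c₀ H₁ c₀⁻¹` at both `w₁` and `w₂`, so `w₁ = w₂` (Thm. 3.7 (ii)) and (b)
excludes it. [cite: MochizukiSemiAnbd2006, Cor 3.9 p.43] -/
theorem centralizer_map_le_of_twoHostsAt_of_noSwapAt (hℋ : Cor39Hypotheses ℋ) (c : TemperedPiChart ℋ)
    (e : ℋ.graph.Edge) (ψ : ℋ.Ge e →ₜ* c.G) (hψ : IsEdgeHom c e ψ) (U : Subgroup (ℋ.Ge e))
    (h2 : ∀ (v₁ v₂ : ℋ.graph.Vertex) (H₁ H₂ : Subgroup c.G), H₁ ∈ verticialSubgroups c v₁ →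
      H₂ ∈ verticialSubgroups c v₂ → H₁ ≠ H₂ → U.map ψ.toMonoidHom ≤ H₁ → U.map ψ.toMonoidHom ≤ H₂ →
        ∀ (v₃ : ℋ.graph.Vertex) (H₃ : Subgroup c.G), H₃ ∈ verticialSubgroups c v₃ →
          U.map ψ.toMonoidHom ≤ H₃ → H₃ = H₁ ∨ H₃ = H₂)
    (hns : ∀ g ∈ Subgroup.centralizer ((U.map ψ.toMonoidHom : Subgroup c.G) : Set c.G),
      ∀ (w : ℋ.graph.Vertex) (H₁ H₂ : Subgroup c.G), H₁ ∈ verticialSubgroups c w →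
        H₂ ∈ verticialSubgroups c w → H₁ ≠ H₂ → U.map ψ.toMonoidHom ≤ H₁ → U.map ψ.toMonoidHom ≤ H₂ →
          H₁.map (MulAut.conj g).toMonoidHom ≠ H₂)
    (v : ℋ.graph.Vertex) (H : Subgroup c.G) (hH : H ∈ verticialSubgroups c v)
    (hUH : U.map ψ.toMonoidHom ≤ H) :
    Subgroup.centralizer ((U.map ψ.toMonoidHom : Subgroup c.G) : Set c.G) ≤ H := by
  have h37 : ℋ.Thm37Hypotheses := hℋ.thm37Hypotheses
  -- the two branches of `e` and their vertices (every edge of a graph is closed)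
  obtain ⟨b₁, b₂, hb12, hb₁e, hb₂e, -⟩ := ℋ.graph.two_branches e
  obtain ⟨w₁, hw₁⟩ := Option.isSome_iff_exists.mp (hℋ.isGraph.abuts_isSome b₁)
  obtain ⟨w₂, hw₂⟩ := Option.isSome_iff_exists.mp (hℋ.isGraph.abuts_isSome b₂)
  set C : Subgroup c.G := U.map ψ.toMonoidHom with hCdef
  intro c₀ hc₀
  -- the edge-like subgroup `L = ψ(Π_e) ⊇ C` and its two hosts at the end-vertices
  have hL : ψ.toMonoidHom.range ∈ edgeLikeSubgroups c e := ⟨ψ, hψ, rfl⟩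
  have hCL : C ≤ ψ.toMonoidHom.range := Subgroup.map_le_range _ _
  obtain ⟨H₁, hH₁, H₂, hH₂, hne, hL1, hL2⟩ :=
    exists_verticial_pair_of_mem_edgeLikeSubgroups verticialInjective_holds hℋ c hb12 hb₁e hb₂e hw₁ hw₂ hL
  have hC1 : C ≤ H₁ := hCL.trans hL1
  have hC2 : C ≤ H₂ := hCL.trans hL2
  -- by (a) they are the ONLY hosts of `C`
  have honly : ∀ (w : ℋ.graph.Vertex) (K : Subgroup c.G), K ∈ verticialSubgroups c w → C ≤ K →
      K = H₁ ∨ K = H₂ := h2 w₁ w₂ H₁ H₂ hH₁ hH₂ hne hC1 hC2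
  -- conjugation by `c₀` permutes `{H₁, H₂}`
  have hσ : ∀ {w : ℋ.graph.Vertex} {K : Subgroup c.G}, K ∈ verticialSubgroups c w → C ≤ K →
      K.map (MulAut.conj c₀).toMonoidHom = H₁ ∨ K.map (MulAut.conj c₀).toMonoidHom = H₂ :=
    fun hK hCK => honly _ _ (conj_mem_verticialSubgroups c hK c₀) (le_map_conj_of_mem_centralizer hc₀ hCK)
  have hinjσ : Function.Injective (Subgroup.map (MulAut.conj c₀).toMonoidHom : Subgroup c.G → _) :=
    Subgroup.map_injective fun a b hab => (MulAut.conj c₀).injective hab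
  -- either a fixed point (then `c₀ ∈ H₁ ⊓ H₂`) or a swap (then `w₁ = w₂`, excluded by (b))
  have hboth : c₀ ∈ H₁ ∧ c₀ ∈ H₂ := by
    rcases hσ hH₁ hC1 with h11 | h12
    · refine ⟨mem_of_map_conj_eq_of_mem_verticialSubgroups verticialDistinct_holds h37 c hH₁ h11, ?_⟩
      rcases hσ hH₂ hC2 with h21 | h22
      · exact absurd (hinjσ (h21.trans h11.symm)) hne.symm
      · exact mem_of_map_conj_eq_of_mem_verticialSubgroups verticialDistinct_holds h37 c hH₂ h22
    · exfalso
      have hH₂' : H₂ ∈ verticialSubgroups c w₁ := h12 ▸ conj_mem_verticialSubgroups c hH₁ c₀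
      have hw : w₁ = w₂ := vertex_eq_of_mem_verticialSubgroups h37 c hH₂' hH₂
      subst hw
      exact hns c₀ hc₀ w₁ H₁ H₂ hH₁ hH₂ hne hC1 hC2 h12
  rcases honly v H hH hUH with rfl | rfl
  · exact hboth.1
  · exact hboth.2

/-- **(R3c) at an edge joining two DISTINCT vertices, from conj 2 of Thm. 3.7 (iii) at `C` ALONE** — for a
non-loop `e` two distinct hosts of `C := ψ(U)` never sit at one vertex (they are the end-vertex hosts, at
`v₁ ≠ v₂`), so hypothesis (b) of `centralizer_map_le_of_twoHostsAt_of_noSwapAt` is vacuous.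
[cite: MochizukiSemiAnbd2006, Cor 3.9 p.43] -/
theorem centralizer_map_le_of_twoHostsAt (hℋ : Cor39Hypotheses ℋ) (c : TemperedPiChart ℋ)
    (e : ℋ.graph.Edge) (he : ∃ v₁ v₂ : ℋ.graph.Vertex, v₁ ≠ v₂ ∧ ℋ.graph.Joins e v₁ v₂)
    (ψ : ℋ.Ge e →ₜ* c.G) (hψ : IsEdgeHom c e ψ) (U : Subgroup (ℋ.Ge e))
    (h2 : ∀ (v₁ v₂ : ℋ.graph.Vertex) (H₁ H₂ : Subgroup c.G), H₁ ∈ verticialSubgroups c v₁ →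
      H₂ ∈ verticialSubgroups c v₂ → H₁ ≠ H₂ → U.map ψ.toMonoidHom ≤ H₁ → U.map ψ.toMonoidHom ≤ H₂ →
        ∀ (v₃ : ℋ.graph.Vertex) (H₃ : Subgroup c.G), H₃ ∈ verticialSubgroups c v₃ →
          U.map ψ.toMonoidHom ≤ H₃ → H₃ = H₁ ∨ H₃ = H₂)
    (v : ℋ.graph.Vertex) (H : Subgroup c.G) (hH : H ∈ verticialSubgroups c v)
    (hUH : U.map ψ.toMonoidHom ≤ H) :
    Subgroup.centralizer ((U.map ψ.toMonoidHom : Subgroup c.G) : Set c.G) ≤ H := by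
  have h37 : ℋ.Thm37Hypotheses := hℋ.thm37Hypotheses
  obtain ⟨v₁, v₂, hv, b₁, b₂, hb12, hb₁e, hb₂e, hw₁, hw₂⟩ := he
  refine centralizer_map_le_of_twoHostsAt_of_noSwapAt hℋ c e ψ hψ U h2 ?_ v H hH hUH
  intro g _ w K₁ K₂ hK₁ hK₂ hKne hCK₁ hCK₂ _
  -- the end-vertex hosts `H₁` (at `v₁`), `H₂` (at `v₂`) are all the hosts of `C`
  obtain ⟨H₁, hH₁, H₂, hH₂, hne, hL1, hL2⟩ :=
    exists_verticial_pair_of_mem_edgeLikeSubgroups verticialInjective_holds hℋ c hb12 hb₁e hb₂e hw₁ hw₂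
      (⟨ψ, hψ, rfl⟩ : ψ.toMonoidHom.range ∈ edgeLikeSubgroups c e)
  have hC1 : U.map ψ.toMonoidHom ≤ H₁ := (Subgroup.map_le_range _ _).trans hL1
  have hC2 : U.map ψ.toMonoidHom ≤ H₂ := (Subgroup.map_le_range _ _).trans hL2
  have honly := h2 v₁ v₂ H₁ H₂ hH₁ hH₂ hne hC1 hC2
  -- two DISTINCT hosts at the one vertex `w` would put `w = v₁` and `w = v₂`
  rcases honly w K₁ hK₁ hCK₁ with rfl | rfl <;> rcases honly w K₂ hK₂ hCK₂ with rfl | rfl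
  · exact hKne rfl
  · exact hv ((vertex_eq_of_mem_verticialSubgroups h37 c hK₁ hH₁).symm.trans
      (vertex_eq_of_mem_verticialSubgroups h37 c hK₂ hH₂))
  · exact hv ((vertex_eq_of_mem_verticialSubgroups h37 c hK₂ hH₁).symm.trans
      (vertex_eq_of_mem_verticialSubgroups h37 c hK₁ hH₂))
  · exact hKne rfl

/-! ### The named form at untangled graphs, and the frozen fact from the sharpened residual -/

/-- **`EdgeLikeCentralizerAt ℋ c` at an UNTANGLED `ℋ` from conj 2 of Thm. 3.7 (iii) at the open pieces of
the edge-like subgroups** (no use of conj 1): every edge of the graph `ℋ` is closed, hence joins two distinct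
vertices, and `centralizer_map_le_of_twoHostsAt` applies.  Covers every tree-shaped `𝔾`, in particular the
rays of the programme REFUTE-F1732 where conj 1 fails on the desk. [cite: MochizukiSemiAnbd2006, Cor 3.9 p.43] -/
theorem edgeLikeCentralizerAt_of_twoHostsAt_of_isUntangled (hℋ : Cor39Hypotheses ℋ)
    (hu : ℋ.graph.IsUntangled) (c : TemperedPiChart ℋ)
    (h2 : ∀ (e : ℋ.graph.Edge) (ψ : ℋ.Ge e →ₜ* c.G), IsEdgeHom c e ψ → ∀ (U : Subgroup (ℋ.Ge e)),
      IsOpen (U : Set (ℋ.Ge e)) →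
      ∀ (v₁ v₂ : ℋ.graph.Vertex) (H₁ H₂ : Subgroup c.G), H₁ ∈ verticialSubgroups c v₁ →
        H₂ ∈ verticialSubgroups c v₂ → H₁ ≠ H₂ → U.map ψ.toMonoidHom ≤ H₁ → U.map ψ.toMonoidHom ≤ H₂ →
          ∀ (v₃ : ℋ.graph.Vertex) (H₃ : Subgroup c.G), H₃ ∈ verticialSubgroups c v₃ →
            U.map ψ.toMonoidHom ≤ H₃ → H₃ = H₁ ∨ H₃ = H₂) :
    EdgeLikeCentralizerAt ℋ c := by
  intro e ψ hψ U hU v H hH hUH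
  -- every edge of a graph is closed
  obtain ⟨b₁, b₂, hb12, hb₁e, hb₂e, -⟩ := ℋ.graph.two_branches e
  obtain ⟨w₁, hw₁⟩ := Option.isSome_iff_exists.mp (hℋ.isGraph.abuts_isSome b₁)
  obtain ⟨w₂, hw₂⟩ := Option.isSome_iff_exists.mp (hℋ.isGraph.abuts_isSome b₂)
  have hclosed : ℋ.graph.IsClosedEdge e :=
    hb₁e ▸ SemiGraph.isClosedEdge_of_abuts hb12 rfl (hb₂e.trans hb₁e.symm) hw₁ hw₂
  exact centralizer_map_le_of_twoHostsAt hℋ c e (hu.joins_ne e hclosed) ψ hψ U (h2 e ψ hψ U hU) v H hH hUH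

/-- **F-2773 `EdgeLikeCentralizer` from the SHARPENED residual**: if at every graph of anabelioids `ℋ`
satisfying the hypotheses of Cor. 3.9 and every chart, (a) conj 2 of Thm. 3.7 (iii) holds at the open
pieces `ψ(U)` of the edge-like subgroups and (b) no `ψ(U)`-centralising element conjugates a verticial host
of `ψ(U)` onto a different host at the same vertex, then `EdgeLikeCentralizer` — conj 1 of Thm. 3.7 (iii)
(in the tree's `edgeLikeCentralizer_of_compactInVerticialAt_cor39`) is no longer bound.
[cite: MochizukiSemiAnbd2006, Cor 3.9 p.43] -/
theorem edgeLikeCentralizer_of_twoHostsAt_of_noSwapAt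
    (h : ∀ (ℋ : ProfiniteSemiGraph.{u}), Cor39Hypotheses ℋ → ∀ (c : TemperedPiChart ℋ)
      (e : ℋ.graph.Edge) (ψ : ℋ.Ge e →ₜ* c.G), IsEdgeHom c e ψ → ∀ (U : Subgroup (ℋ.Ge e)),
      IsOpen (U : Set (ℋ.Ge e)) →
      (∀ (v₁ v₂ : ℋ.graph.Vertex) (H₁ H₂ : Subgroup c.G), H₁ ∈ verticialSubgroups c v₁ →
        H₂ ∈ verticialSubgroups c v₂ → H₁ ≠ H₂ → U.map ψ.toMonoidHom ≤ H₁ → U.map ψ.toMonoidHom ≤ H₂ →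
          ∀ (v₃ : ℋ.graph.Vertex) (H₃ : Subgroup c.G), H₃ ∈ verticialSubgroups c v₃ →
            U.map ψ.toMonoidHom ≤ H₃ → H₃ = H₁ ∨ H₃ = H₂) ∧
      (∀ g ∈ Subgroup.centralizer ((U.map ψ.toMonoidHom : Subgroup c.G) : Set c.G),
        ∀ (w : ℋ.graph.Vertex) (H₁ H₂ : Subgroup c.G), H₁ ∈ verticialSubgroups c w →
          H₂ ∈ verticialSubgroups c w → H₁ ≠ H₂ → U.map ψ.toMonoidHom ≤ H₁ → U.map ψ.toMonoidHom ≤ H₂ →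
            H₁.map (MulAut.conj g).toMonoidHom ≠ H₂)) :
    Literature.AnabelianGeometry.SemiGraphs.ProfiniteSemiGraph.EdgeLikeCentralizer.{u} :=
  fun ℋ hℋ c e ψ hψ U hU v H hH hUH =>
    centralizer_map_le_of_twoHostsAt_of_noSwapAt hℋ c e ψ hψ U (h ℋ hℋ c e ψ hψ U hU).1
      (h ℋ hℋ c e ψ hψ U hU).2 v H hH hUH

/-! ### Comparison: Theorem 3.7 (iii) AT `ℋ` implies both sharpened hypotheses -/

/-- Conj 2 of Thm. 3.7 (iii) at a nontrivial compact `C` is a conjunct of `CompactInVerticialAt ℋ`.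
[cite: MochizukiSemiAnbd2006, Thm 3.7(iii) pp.40-41] -/
theorem twoHostsAt_of_compactInVerticialAt (hCV : CompactInVerticialAt ℋ) (h37 : ℋ.Thm37Hypotheses)
    (c : TemperedPiChart ℋ) (C : Subgroup c.G) (hC : IsCompact (C : Set c.G)) (hCne : C ≠ ⊥) :
    ∀ (v₁ v₂ : ℋ.graph.Vertex) (H₁ H₂ : Subgroup c.G), H₁ ∈ verticialSubgroups c v₁ →
      H₂ ∈ verticialSubgroups c v₂ → H₁ ≠ H₂ → C ≤ H₁ → C ≤ H₂ →
        ∀ (v₃ : ℋ.graph.Vertex) (H₃ : Subgroup c.G), H₃ ∈ verticialSubgroups c v₃ → C ≤ H₃ →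
          H₃ = H₁ ∨ H₃ = H₂ :=
  fun v₁ v₂ H₁ H₂ hH₁ hH₂ hne hC1 hC2 => ((hCV h37 c C hC).2 hCne v₁ v₂ H₁ H₂ hH₁ hH₂ hne hC1 hC2).1

/-- **«No swap» from Thm. 3.7 (iii) AT `ℋ`** — the one place where conj 1 enters the tree's proof of (R3c),
isolated: if a `C`-centralising `c₀` swapped two hosts `H₁ ≠ H₂` of the nontrivial compact `C`, then
`c₀² ∈ H₁ ⊓ H₂ =: N`, `c₀` normalises `N`, the closure `K` of `⟨N, c₀⟩ = N ∪ N c₀` is compact, so by conj 1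
`K` lies in a verticial `H₃ ⊇ C`, which by conj 2 is `H₁` or `H₂` and contains `c₀` — contradicting the swap
(a subgroup is fixed by conjugation by its own elements). [cite: MochizukiSemiAnbd2006, Thm 3.7(iii) pp.40-41] -/
theorem noSwapAt_of_compactInVerticialAt (hCV : CompactInVerticialAt ℋ) (h37 : ℋ.Thm37Hypotheses)
    (c : TemperedPiChart ℋ) (C : Subgroup c.G) (hC : IsCompact (C : Set c.G)) (hCne : C ≠ ⊥) :
    ∀ g ∈ Subgroup.centralizer (C : Set c.G), ∀ (w : ℋ.graph.Vertex) (H₁ H₂ : Subgroup c.G),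
      H₁ ∈ verticialSubgroups c w → H₂ ∈ verticialSubgroups c w → H₁ ≠ H₂ → C ≤ H₁ → C ≤ H₂ →
        H₁.map (MulAut.conj g).toMonoidHom ≠ H₂ := by
  intro c₀ hc₀ w H₁ H₂ hH₁ hH₂ hne hC1 hC2 h12
  haveI : T2Space c.G := c.t2Space
  have honly : ∀ (w' : ℋ.graph.Vertex) (K : Subgroup c.G), K ∈ verticialSubgroups c w' → C ≤ K →
      K = H₁ ∨ K = H₂ := twoHostsAt_of_compactInVerticialAt hCV h37 c C hC hCne w w H₁ H₂ hH₁ hH₂ hne hC1 hC2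
  have hinjσ : Function.Injective (Subgroup.map (MulAut.conj c₀).toMonoidHom : Subgroup c.G → _) :=
    Subgroup.map_injective fun a b hab => (MulAut.conj c₀).injective hab
  -- the swap: `σ H₂ = H₁`
  have h21 : H₂.map (MulAut.conj c₀).toMonoidHom = H₁ := by
    rcases honly w _ (conj_mem_verticialSubgroups c hH₂ c₀) (le_map_conj_of_mem_centralizer hc₀ hC2) with
      h21 | h22
    · exact h21
    · exact absurd (hinjσ (h22.trans h12.symm)) hne.symm
  -- `σ² = id` on the hosts, so `c₀² ∈ N := H₁ ⊓ H₂`, and `σ N = N`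
  have hsq1 : c₀ * c₀ ∈ H₁ := by
    refine mem_of_map_conj_eq_of_mem_verticialSubgroups verticialDistinct_holds h37 c hH₁ ?_
    rw [← map_conj_map_conj, h12, h21]
  have hsq2 : c₀ * c₀ ∈ H₂ := by
    refine mem_of_map_conj_eq_of_mem_verticialSubgroups verticialDistinct_holds h37 c hH₂ ?_
    rw [← map_conj_map_conj, h21, h12]
  set N : Subgroup c.G := H₁ ⊓ H₂ with hNdef
  have hNfix : N.map (MulAut.conj c₀).toMonoidHom = N := by
    rw [hNdef, Subgroup.map_inf_eq _ _ _ fun a b hab => (MulAut.conj c₀).injective hab, h12, h21, inf_comm]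
  have hc₀N : c₀ ∈ Subgroup.normalizer (N : Set c.G) := by
    rw [Subgroup.mem_normalizer_iff]
    intro x
    constructor
    · intro hx
      rw [← hNfix]
      exact ⟨x, hx, rfl⟩
    · intro hx
      rw [← hNfix] at hx
      obtain ⟨y, hy, hyx⟩ := hx
      have : y = x := (MulAut.conj c₀).injective (by simpa [MulAut.conj_apply] using hyx)
      exact this ▸ hy
  -- the subgroup generated by `N` and `c₀` has compact closure `K`
  have hNcpt : IsCompact (N : Set c.G) := by
    rw [hNdef, Subgroup.coe_inf]
    exact (isCompact_of_mem_verticialSubgroups c hH₁).inter_right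
      (isCompact_of_mem_verticialSubgroups c hH₂).isClosed
  let S : Set c.G := (N : Set c.G) ∪ (fun x => x * c₀) '' (N : Set c.G)
  have hScpt : IsCompact S := hNcpt.union (hNcpt.image (continuous_id.mul continuous_const))
  have hzle : Subgroup.zpowers c₀ ≤ Subgroup.normalizer (N : Set c.G) := Subgroup.zpowers_le.mpr hc₀N
  have hDS : ((N ⊔ Subgroup.zpowers c₀ : Subgroup c.G) : Set c.G) ⊆ S := by
    rw [Subgroup.coe_mul_of_right_le_normalizer_left N _ hzle]
    rintro _ ⟨n, hn, z, hz, rfl⟩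
    obtain ⟨m, rfl⟩ := Subgroup.mem_zpowers_iff.mp hz
    have hsqN : c₀ * c₀ ∈ N := ⟨hsq1, hsq2⟩
    rcases Int.even_or_odd' m with ⟨k, rfl | rfl⟩
    · left
      have : c₀ ^ (2 * k) = (c₀ * c₀) ^ k := by rw [zpow_mul]; simp [sq, zpow_ofNat]
      rw [this]
      exact N.mul_mem hn (N.zpow_mem hsqN k)
    · right
      refine ⟨n * (c₀ * c₀) ^ k, N.mul_mem hn (N.zpow_mem hsqN k), ?_⟩
      change n * (c₀ * c₀) ^ k * c₀ = n * c₀ ^ (2 * k + 1)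
      rw [zpow_add_one, zpow_mul]
      simp [sq, zpow_ofNat, mul_assoc]
  let K : Subgroup c.G := (N ⊔ Subgroup.zpowers c₀).topologicalClosure
  have hKcpt : IsCompact (K : Set c.G) := by
    have hcl : (K : Set c.G) = closure ((N ⊔ Subgroup.zpowers c₀ : Subgroup c.G) : Set c.G) :=
      Subgroup.topologicalClosure_coe
    rw [hcl]
    exact hScpt.of_isClosed_subset isClosed_closure (closure_minimal hDS hScpt.isClosed)
  -- conj 1: `K` lies in a verticial `H₃`, which contains `C` and `c₀`, hence is `H₁` or `H₂` — no swap
  obtain ⟨⟨v₃, H₃, hH₃, hKH₃⟩, -⟩ := hCV h37 c K hKcpt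
  have hDK : N ⊔ Subgroup.zpowers c₀ ≤ K := Subgroup.le_topologicalClosure _
  have hC3 : C ≤ H₃ := (le_inf hC1 hC2).trans (le_sup_left.trans (hDK.trans hKH₃))
  have hc₀3 : c₀ ∈ H₃ := hKH₃ (hDK (Subgroup.mem_sup_right (Subgroup.mem_zpowers c₀)))
  rcases honly v₃ H₃ hH₃ hC3 with rfl | rfl
  · exact hne ((map_conj_eq_self_of_mem hc₀3).symm.trans h12)
  · exact hne ((map_conj_eq_self_of_mem hc₀3).symm.trans h21).symm

/-- An open piece `ψ(U)` of an edge-like subgroup is a NONTRIVIAL COMPACT subgroup under the hypotheses of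
Cor. 3.9 (`Π_e` is infinite by total aloofness at an elevated end-vertex, `ψ` is injective by Thm. 3.7 (i),
`U` is closed of finite index). [cite: MochizukiSemiAnbd2006, Cor 3.9 p.43] -/
theorem isCompact_map_and_ne_bot_of_isEdgeHom (hℋ : Cor39Hypotheses ℋ) (c : TemperedPiChart ℋ)
    (e : ℋ.graph.Edge) (ψ : ℋ.Ge e →ₜ* c.G) (hψ : IsEdgeHom c e ψ) (U : Subgroup (ℋ.Ge e))
    (hU : IsOpen (U : Set (ℋ.Ge e))) :
    IsCompact ((U.map ψ.toMonoidHom : Subgroup c.G) : Set c.G) ∧ U.map ψ.toMonoidHom ≠ ⊥ := by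
  have h37 : ℋ.Thm37Hypotheses := hℋ.thm37Hypotheses
  obtain ⟨b₁, b₂, -, rfl, -, -⟩ := ℋ.graph.two_branches e
  obtain ⟨w₁, hw₁⟩ := Option.isSome_iff_exists.mp (hℋ.isGraph.abuts_isSome b₁)
  have hψinj : Function.Injective ψ := injective_of_isEdgeHom verticialInjective_holds h37 c b₁ w₁ hw₁ ψ hψ
  haveI hGeInf : Infinite (ℋ.Ge (ℋ.graph.edgeOf b₁)) :=
    @Infinite.of_surjective _ (ℋ.branchSubgroup b₁ w₁ hw₁)
      (infinite_branchSubgroup h37.toProp36Hypotheses hw₁)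
      (ℋ.brHom b₁ w₁ hw₁).toMonoidHom.rangeRestrict (ℋ.brHom b₁ w₁ hw₁).toMonoidHom.rangeRestrict_surjective
  haveI hUinf : Infinite U := by
    haveI := Subgroup.quotient_finite_of_isOpen U hU
    by_contra hfin
    rw [not_infinite_iff_finite] at hfin
    have hcard := Subgroup.card_mul_index U
    have h1 : Nat.card U ≠ 0 := Nat.card_pos.ne'
    have h2 : U.index ≠ 0 := Subgroup.index_ne_zero_of_finite
    have h3 : Nat.card (ℋ.Ge (ℋ.graph.edgeOf b₁)) = 0 := Nat.card_eq_zero_of_infinite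
    rw [h3] at hcard
    exact (mul_ne_zero h1 h2) hcard
  haveI hCinf : Infinite (U.map ψ.toMonoidHom) :=
    Infinite.of_injective _ (Subgroup.equivMapOfInjective U ψ.toMonoidHom hψinj).injective
  refine ⟨?_, fun hbot => ?_⟩
  · have hUc : IsCompact (U : Set (ℋ.Ge (ℋ.graph.edgeOf b₁))) :=
      (Subgroup.isClosed_of_isOpen U hU).isCompact
    simpa [Subgroup.coe_map] using hUc.image ψ.continuous
  · rw [hbot] at hCinf
    exact not_finite (⊥ : Subgroup c.G)

end ProfiniteSemiGraph

end Literature.AnabelianGeometry.SemiGraphs
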